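import Literature.MathematicalPhysics.QuantumFieldTheory.ConformalBootstrap3D.BlockCoefficientExtraction
import Literature.MathematicalPhysics.QuantumFieldTheory.ConformalBootstrap3D.DiagonalSeriesEnclosure
import Mathlib.Tactic
import HarnessLib

/-!
# End-to-end enclosure of the diagonal of a typed 3D conformal block (equal external dimensions)

pub-ising3d REFEREE T1, assembled: for `Δ` strictly above the unitarity bound and off the accidental
degeneracies, ANY function `g` satisfying the genuine block predicate `IsConformalBlock3D 0 0 Δ ℓ g` has, on
the diagonal `z = z̄ = y ∈ (0,1)`, the value of the positive Hogervorst–Rychkov series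
`g(y,y) = Σ_n a_n y^{Δ+n}`, `a_n = hrLevelSum Δ ℓ n / λ_ℓ ≥ 0` (`BlockCoefficientExtraction`,
`IsConformalBlock3D.hasSum_diag_hr`), and therefore obeys the elementary two-sided cell enclosure of
`DiagonalSeriesEnclosure.tsum_rpow_mem_Icc`: for `0 < y ≤ y' < 1`, any truncation order `N` and any upper
bound `U ≥ g(y',y')`,
`S_N(y) ≤ g(y,y) ≤ S_N(y) + (y/y')^{Δ+N+1} (U - S_N(y'))`, `S_N(y) = Σ_{n ≤ N} a_n y^{Δ+n}`
(`IsConformalBlock3D.diag_mem_Icc`) — the statement a per-cell interval evaluator certifies, now with the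
typed predicate (not a series ansatz) as its hypothesis. Also: `g(y,y) ≥ y^Δ/λ_ℓ > 0` and the ratio
domination `g(y,y) ≤ (y/y')^Δ g(y',y')`. Elementary assembly of landed results; the sources are those of the
ingredients (Dolan–Osborn 2011 §2 for the Casimir equation, Hogervorst–Rychkov 2013 §3 eqs. (3.4), (3.9) for
the positive series). No claim at `Δ = ℓ + 1` or at accidental degeneracies.
-/

namespace Literature.MathematicalPhysics.QuantumFieldTheory.ConformalBootstrap3D

open Set Finset

/-- The diagonal coefficient of a 3D block with equal external dimensions in the Dolan–Osborn
normalisation: `a_n = (Σ_j B_{n,j}) / λ_ℓ`, `λ_ℓ = binom(2ℓ,ℓ)/4^ℓ`.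
[cite: HogervorstRychkov2013, §3 eq. (3.9)] -/
noncomputable def hrDiagCoeff (Δ : ℝ) (ℓ n : ℕ) : ℝ := hrLevelSum Δ ℓ n / legendreLam ℓ

/-- `a_n ≥ 0` above the unitarity bound. [cite: HogervorstRychkov2013, §3 eq. (3.9)] -/
theorem hrDiagCoeff_nonneg {Δ : ℝ} {ℓ : ℕ} (hΔ : unitarityBound3D ℓ < Δ) (n : ℕ) :
    0 ≤ hrDiagCoeff Δ ℓ n :=
  div_nonneg (hrLevelSum_nonneg hΔ n) (legendreLam_pos ℓ).le

/-- `a_0 = 1/λ_ℓ > 0`. [cite: HogervorstRychkov2013, §3 eq. (3.9)] -/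
theorem hrDiagCoeff_zero (Δ : ℝ) (ℓ : ℕ) : hrDiagCoeff Δ ℓ 0 = 1 / legendreLam ℓ := by
  rw [hrDiagCoeff, hrLevelSum_zero]

/-- `a_0 > 0`. [cite: HogervorstRychkov2013, §3 eq. (3.9)] -/
theorem hrDiagCoeff_zero_pos (Δ : ℝ) (ℓ : ℕ) : 0 < hrDiagCoeff Δ ℓ 0 := by
  rw [hrDiagCoeff_zero]; exact div_pos one_pos (legendreLam_pos ℓ)

/-- The truncated diagonal series `S_N(y) = Σ_{n ≤ N} a_n y^{Δ+n}` — a finite, explicitly computable sum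
of rational functions of `Δ` times powers of `y`. [cite: HogervorstRychkov2013, §3 eq. (3.9)] -/
noncomputable def hrDiagPartialSum (Δ : ℝ) (ℓ N : ℕ) (y : ℝ) : ℝ :=
  ∑ n ∈ range (N + 1), hrDiagCoeff Δ ℓ n * y ^ (Δ + n)

/-- The diagonal of a typed block IS the HR series (`HasSum` form, coefficients `hrDiagCoeff`).
[cite: HogervorstRychkov2013, §3 eqs. (3.4), (3.9)] -/
theorem IsConformalBlock3D.hasSum_diag {Δ : ℝ} {ℓ : ℕ} {g : ℝ → ℝ → ℝ}
    (hΔ : unitarityBound3D ℓ < Δ) (hreg : ¬ accidentalDegeneracy3D Δ ℓ)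
    (h : IsConformalBlock3D 0 0 Δ ℓ g) {y : ℝ} (hy : y ∈ Ioo (0 : ℝ) 1) :
    HasSum (fun n : ℕ => hrDiagCoeff Δ ℓ n * y ^ (Δ + n)) (g y y) :=
  h.hasSum_diag_hr hΔ hreg hy

/-- Summability of the diagonal series of a typed block at every `y ∈ (0,1)`.
[cite: HogervorstRychkov2013, §3 eqs. (3.4), (3.9)] -/
theorem IsConformalBlock3D.summable_diag {Δ : ℝ} {ℓ : ℕ} {g : ℝ → ℝ → ℝ}
    (hΔ : unitarityBound3D ℓ < Δ) (hreg : ¬ accidentalDegeneracy3D Δ ℓ)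
    (h : IsConformalBlock3D 0 0 Δ ℓ g) {y : ℝ} (hy : y ∈ Ioo (0 : ℝ) 1) :
    Summable fun n : ℕ => hrDiagCoeff Δ ℓ n * y ^ (Δ + n) :=
  (h.hasSum_diag hΔ hreg hy).summable

/-- The diagonal value as a `tsum`. [cite: HogervorstRychkov2013, §3 eqs. (3.4), (3.9)] -/
theorem IsConformalBlock3D.diag_eq_tsum {Δ : ℝ} {ℓ : ℕ} {g : ℝ → ℝ → ℝ}
    (hΔ : unitarityBound3D ℓ < Δ) (hreg : ¬ accidentalDegeneracy3D Δ ℓ)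
    (h : IsConformalBlock3D 0 0 Δ ℓ g) {y : ℝ} (hy : y ∈ Ioo (0 : ℝ) 1) :
    g y y = ∑' n : ℕ, hrDiagCoeff Δ ℓ n * y ^ (Δ + n) :=
  (h.hasSum_diag hΔ hreg hy).tsum_eq.symm

/-- **Lower bounds.** Every truncation is a lower bound: `S_N(y) ≤ g(y,y)`.
[cite: HogervorstRychkov2013, §3 eq. (3.9)] -/
theorem IsConformalBlock3D.partialSum_le_diag {Δ : ℝ} {ℓ : ℕ} {g : ℝ → ℝ → ℝ}
    (hΔ : unitarityBound3D ℓ < Δ) (hreg : ¬ accidentalDegeneracy3D Δ ℓ)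
    (h : IsConformalBlock3D 0 0 Δ ℓ g) {y : ℝ} (hy : y ∈ Ioo (0 : ℝ) 1) (N : ℕ) :
    hrDiagPartialSum Δ ℓ N y ≤ g y y := by
  rw [h.diag_eq_tsum hΔ hreg hy]
  exact partialSum_le_tsum_rpow (hrDiagCoeff_nonneg hΔ) hy.1.le (h.summable_diag hΔ hreg hy) N

/-- **The leading power is a lower bound**: `y^Δ / λ_ℓ ≤ g(y,y)`; in particular `g(y,y) > 0` on the
diagonal. [cite: HogervorstRychkov2013, §3 eq. (3.9)] -/
theorem IsConformalBlock3D.rpow_div_le_diag {Δ : ℝ} {ℓ : ℕ} {g : ℝ → ℝ → ℝ}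
    (hΔ : unitarityBound3D ℓ < Δ) (hreg : ¬ accidentalDegeneracy3D Δ ℓ)
    (h : IsConformalBlock3D 0 0 Δ ℓ g) {y : ℝ} (hy : y ∈ Ioo (0 : ℝ) 1) :
    y ^ Δ / legendreLam ℓ ≤ g y y := by
  have h1 := first_term_le_tsum (hrDiagCoeff_nonneg hΔ) hy.1.le (h.summable_diag hΔ hreg hy)
  rw [← h.diag_eq_tsum hΔ hreg hy, hrDiagCoeff_zero] at h1
  simpa [div_eq_inv_mul] using h1

/-- Positivity of a typed block on the diagonal. [cite: HogervorstRychkov2013, §3 eq. (3.9)] -/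
theorem IsConformalBlock3D.diag_pos {Δ : ℝ} {ℓ : ℕ} {g : ℝ → ℝ → ℝ}
    (hΔ : unitarityBound3D ℓ < Δ) (hreg : ¬ accidentalDegeneracy3D Δ ℓ)
    (h : IsConformalBlock3D 0 0 Δ ℓ g) {y : ℝ} (hy : y ∈ Ioo (0 : ℝ) 1) : 0 < g y y := by
  rw [h.diag_eq_tsum hΔ hreg hy]
  exact tsum_rpow_pos (hrDiagCoeff_nonneg hΔ) (hrDiagCoeff_zero_pos Δ ℓ) hy.1
    (h.summable_diag hΔ hreg hy)

/-- **Ratio domination along the diagonal**: for `0 < y ≤ y' < 1`,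
`g(y,y) ≤ (y/y')^Δ g(y',y')`. [cite: HogervorstRychkov2013, §3 eq. (3.9)] -/
theorem IsConformalBlock3D.diag_ratio_le {Δ : ℝ} {ℓ : ℕ} {g : ℝ → ℝ → ℝ}
    (hΔ : unitarityBound3D ℓ < Δ) (hreg : ¬ accidentalDegeneracy3D Δ ℓ)
    (h : IsConformalBlock3D 0 0 Δ ℓ g) {y y' : ℝ} (hy : 0 < y) (hyy' : y ≤ y') (hy'1 : y' < 1) :
    g y y ≤ (y / y') ^ Δ * g y' y' := by
  have hyI : y ∈ Ioo (0 : ℝ) 1 := ⟨hy, lt_of_le_of_lt hyy' hy'1⟩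
  have hy'I : y' ∈ Ioo (0 : ℝ) 1 := ⟨lt_of_lt_of_le hy hyy', hy'1⟩
  rw [h.diag_eq_tsum hΔ hreg hyI, h.diag_eq_tsum hΔ hreg hy'I]
  exact tsum_rpow_ratio_le (hrDiagCoeff_nonneg hΔ) hy hyy' (h.summable_diag hΔ hreg hy'I)

/-- **End-to-end cell enclosure of a typed block on the diagonal.** For `Δ` strictly above the unitarity
bound and off the accidental degeneracies, `g` any function with `IsConformalBlock3D 0 0 Δ ℓ g`,
`0 < y ≤ y' < 1`, a truncation order `N` and an upper bound `U ≥ g(y',y')`: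
`g(y,y) ∈ [S_N(y), S_N(y) + (y/y')^{Δ+N+1} (U − S_N(y'))]`. Both endpoints are finite closed-form
expressions in `(Δ, ℓ, N, y, y', U)`. [cite: HogervorstRychkov2013, §3 eqs. (3.4), (3.9)] -/
theorem IsConformalBlock3D.diag_mem_Icc {Δ : ℝ} {ℓ : ℕ} {g : ℝ → ℝ → ℝ}
    (hΔ : unitarityBound3D ℓ < Δ) (hreg : ¬ accidentalDegeneracy3D Δ ℓ)
    (h : IsConformalBlock3D 0 0 Δ ℓ g) {y y' U : ℝ} (hy : 0 < y) (hyy' : y ≤ y') (hy'1 : y' < 1)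
    (N : ℕ) (hU : g y' y' ≤ U) :
    g y y ∈ Icc (hrDiagPartialSum Δ ℓ N y)
      (hrDiagPartialSum Δ ℓ N y + (y / y') ^ (Δ + N + 1) * (U - hrDiagPartialSum Δ ℓ N y')) := by
  have hyI : y ∈ Ioo (0 : ℝ) 1 := ⟨hy, lt_of_le_of_lt hyy' hy'1⟩
  have hy'I : y' ∈ Ioo (0 : ℝ) 1 := ⟨lt_of_lt_of_le hy hyy', hy'1⟩
  have hU' : ∑' n : ℕ, hrDiagCoeff Δ ℓ n * y' ^ (Δ + n) ≤ U := by
    rw [← h.diag_eq_tsum hΔ hreg hy'I]; exact hU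
  rw [h.diag_eq_tsum hΔ hreg hyI]
  exact tsum_rpow_mem_Icc (hrDiagCoeff_nonneg hΔ) hy hyy' (h.summable_diag hΔ hreg hy'I) N hU'

/-- **Self-bounding cell enclosure** (no external upper bound needed): taking `y' = y` is useless, but
taking `U = g(y',y')` itself expresses the enclosure purely through the block:
`g(y,y) ≤ S_N(y) + (y/y')^{Δ+N+1} (g(y',y') − S_N(y'))`. [cite: HogervorstRychkov2013, §3 eq. (3.9)] -/
theorem IsConformalBlock3D.diag_le_partialSum_add_tail {Δ : ℝ} {ℓ : ℕ} {g : ℝ → ℝ → ℝ}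
    (hΔ : unitarityBound3D ℓ < Δ) (hreg : ¬ accidentalDegeneracy3D Δ ℓ)
    (h : IsConformalBlock3D 0 0 Δ ℓ g) {y y' : ℝ} (hy : 0 < y) (hyy' : y ≤ y') (hy'1 : y' < 1)
    (N : ℕ) :
    g y y ≤ hrDiagPartialSum Δ ℓ N y
      + (y / y') ^ (Δ + N + 1) * (g y' y' - hrDiagPartialSum Δ ℓ N y') :=
  (h.diag_mem_Icc hΔ hreg hy hyy' hy'1 N le_rfl).2

end Literature.MathematicalPhysics.QuantumFieldTheory.ConformalBootstrap3D
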